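import Summits.HodgeConjecture.HodgeConjecture.Theorems.F0P3cStCharTSUpTrU2Levels     -- ★∕filed (B2a) p852399 (this seat): `mem_level_inf_Nbar_iff`, `mem_level_iff_of_mem_unipotentU_two`; brings ★ `F0P3cIwahoriDatumU2Alg`, ★ LineRing
import HarnessLib

/-!
# F0 · P3c · ROAD «UP-TR» ∕ «JAC-LOC₂» brick (B2a), sequel «TWIST₂»: the torus twist of the line boxes `t⁻¹ N[r] t = N[v(d₀⁻¹d₁)·r]` in `U(σ, Φ₂)(K)` and `K_δ ∩ N̄₂` entrywise

Cell `pub/hodgecm-mathlib`, crux H413 = `stmt-HodgeConjecture-24833` (lane `--supports … --as helper`), route HCCMUnconditional; seat LH4-p03 (g9); ROAD «UP-TR» (holder F0P3-p02 (g23)),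
sub-road «JAC-LOC₂» (sub-dealer LH7-p02 (g8), DEAL #3 2026-09-02 18:39:41Z: «(B2a) LEVEL-BOXES₂ core … twist `m⁻¹ N[r] m = N[r ∕ |a|]`»).  THEOREMS ONLY (no `def`, no instance, no
notation, no named fact, no `sorry`); imports the filed (B2a) `F0P3cStCharTSUpTrU2Levels` only.
THE MATHEMATICS.  `U′ = U(σ, J)(K)` (`2 × 2`), `N₂ = unipotentU σ J` with the line coordinate `u ↦ u₀₁` (★ `UnitaryGroupLineUnipotentRing`), `T₂ = torusU σ J ∋ t = diag(d)`.  Then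
`(t⁻¹ u t)₀₁ = d₀⁻¹d₁ · u₀₁` (★ `LineRing.umat_conj_zero_one_two`; for `t = m(d, σd⁻¹)` the scalar `d₀⁻¹d₁ = (d·σd)⁻¹ = a(t)⁻¹` is the inverse root value, ★
`LineRing.coe_inv_mul_mul_norm_two`), so `v((t⁻¹ u t)₀₁) = v(d₀⁻¹d₁) · v(u₀₁)` (`valuation_conj_entry_zero_one_two`) and, `d₀⁻¹d₁` being a unit, the twist `x ↦ t⁻¹ x t` maps the line box
`N[r] = {x ∈ N₂ ∣ v(x₀₁) ≤ r}` ONTO `N[v(d₀⁻¹d₁)·r]` for every radius (`image_conj_lineBox_eq_two` — the road's «`m⁻¹ N[r] m = N[r ∕ |a|]`»; the inverse twist is conjugation by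
`t⁻¹ = diag(d⁻¹)`).  Finally (L2)₂ `mem_level_inf_Nbar_iff_two`: `x ∈ K_δ ∩ w₀N₂w₀ ↔ x = w₀ u w₀` with `u ∈ N₂`, `v(u₀₁) ≤ δ` (`δ < 1`; ★ (B2a) any-rank (L2) + (L1)₂).
HONEST LABEL: HC_CM is proved only modulo the 7 printed citations (2 remaining: hLiu418 = `stmt-HodgeConjecture-24832`, h413 = `stmt-HodgeConjecture-24833`) until rung 0 closes;
count-neutral (hyperbolic `H`-Jacobian road of the in-house `hUpTr`; pays no organ).

## References
* [vanDijk1972] G. van Dijk, *Computation of certain induced characters of `p`-adic groups*, Math. Ann. 199 (1972), §2.  [Casselman1995] W. Casselman, *Introduction to the theory of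
  admissible representations of `p`-adic reductive groups* (1995), Prop. 1.4.4.  [Rogawski1990] J. D. Rogawski, Ann. of Math. Stud. 123 (1990), §1.10 p. 9; §4.9 p. 55; §12.5 p. 182.
-/
set_option autoImplicit false
-- the mandated namespace has the single-problem summit's repeated segment (`HodgeConjecture.HodgeConjecture`)
set_option linter.dupNamespace false
noncomputable section

open Matrix ValuativeRel
open scoped MatrixGroups
open Literature.NumberTheory.Automorphic Literature.NumberTheory.Automorphic.UnitaryGroup Literature.NumberTheory.Automorphic.UnitaryGroup.LineRing
open Summit.HodgeConjecture.HodgeConjecture.Cruxes.H413.F0P3cIwahoriDatumU2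
open Summit.HodgeConjecture.HodgeConjecture.Cruxes.H413.F0P3cStCharTSUpTrU2Levels

namespace Summit.HodgeConjecture.HodgeConjecture.Cruxes.H413.F0P3cStCharTSUpTrU2LevelsTwist

/-! ## §1 The twist of the line boxes; §2 `K_δ ∩ N̄₂` entrywise -/
section Twist
variable {K : Type*} [Field K] [ValuativeRel K] (σ : K →+* K) {J : Matrix (Fin 2) (Fin 2) K}

/-- **The torus twist in the line chart, valuation form**: for `t = diag(d) ∈ T₂` and `u ∈ U′`, `v((t⁻¹ u t)₀₁) = v(d₀⁻¹d₁) · v(u₀₁)` (★ `LineRing.umat_conj_zero_one_two`; for `t ∈ T₂`,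
`d₀⁻¹d₁ = N(d₀)⁻¹ = a(t)⁻¹` ★ `LineRing.coe_inv_mul_mul_norm_two` — the van Dijk twist `a⁻¹` of (B1) §4). [cite: Rogawski1990, §4.9 p. 55] [cite: vanDijk1972, §2] -/
theorem valuation_conj_entry_zero_one_two {t : ↥(unitaryGroupOfForm σ J)} {d : Fin 2 → Kˣ} (hd : glDiagonal 2 K d = (t : GL (Fin 2) K))
    (u : ↥(unitaryGroupOfForm σ J)) :
    valuation K ((((t⁻¹ * u * t : ↥(unitaryGroupOfForm σ J)) : GL (Fin 2) K) : Matrix (Fin 2) (Fin 2) K) 0 1) =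
      valuation K (((d 0)⁻¹ * d 1 : Kˣ) : K) * valuation K ((((u : ↥(unitaryGroupOfForm σ J)) : GL (Fin 2) K) : Matrix (Fin 2) (Fin 2) K) 0 1) := by
  rw [umat_conj_zero_one_two σ hd, map_mul]

/-- **THE TWIST OF A LINE BOX: `t⁻¹ N[r] t = N[v(d₀⁻¹d₁)·r]`** for `t = diag(d) ∈ T₂` and every radius `r` (as subsets of `U′`; `t⁻¹ N t = N` ★ `LineRing.torus_inv_conj_mem_unipotentU_iff`,
the coordinate scales by the unit `d₀⁻¹d₁`; the inverse twist is conjugation by `t⁻¹ = diag(d⁻¹)`) — the rank-2 «`m⁻¹ N[r] m = N[r ∕ |a|]`» of the JAC-LOC₂ road.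
[cite: vanDijk1972, §2] [cite: Rogawski1990, §4.9 p. 55; §12.5 p. 182] -/
theorem image_conj_lineBox_eq_two {t : ↥(unitaryGroupOfForm σ J)} (ht : t ∈ torusU σ J) {d : Fin 2 → Kˣ} (hd : glDiagonal 2 K d = (t : GL (Fin 2) K))
    (r : ValueGroupWithZero K) :
    (fun x : ↥(unitaryGroupOfForm σ J) => t⁻¹ * x * t) ''
        {x | x ∈ unipotentU σ J ∧ valuation K (((x : GL (Fin 2) K) : Matrix (Fin 2) (Fin 2) K) 0 1) ≤ r} =
      {x | x ∈ unipotentU σ J ∧ valuation K (((x : GL (Fin 2) K) : Matrix (Fin 2) (Fin 2) K) 0 1) ≤ valuation K (((d 0)⁻¹ * d 1 : Kˣ) : K) * r} := by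
  have hti : t⁻¹ ∈ torusU σ J := inv_mem ht
  have hdi : glDiagonal 2 K d⁻¹ = ((t⁻¹ : ↥(unitaryGroupOfForm σ J)) : GL (Fin 2) K) := by rw [map_inv, hd, Subgroup.coe_inv]
  -- the twist scalars of `t` and `t⁻¹` are mutually inverse units
  have hbb : ((((d⁻¹ 0)⁻¹ * d⁻¹ 1 : Kˣ) : K)) * (((d 0)⁻¹ * d 1 : Kˣ) : K) = 1 := by
    rw [← Units.val_mul, Pi.inv_apply, Pi.inv_apply, inv_inv]
    have : d 0 * (d 1)⁻¹ * ((d 0)⁻¹ * d 1) = 1 := by rw [mul_mul_mul_comm, mul_inv_cancel, inv_mul_cancel, one_mul]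
    rw [this, Units.val_one]
  have hb0 : valuation K (((d 0)⁻¹ * d 1 : Kˣ) : K) ≠ 0 := (Valuation.ne_zero_iff _).2 (Units.ne_zero _)
  ext x
  simp only [Set.mem_image, Set.mem_setOf_eq]
  constructor
  · rintro ⟨y, ⟨hyN, hyr⟩, rfl⟩
    refine ⟨(torus_inv_conj_mem_unipotentU_iff σ J ht y).2 hyN, ?_⟩
    rw [valuation_conj_entry_zero_one_two σ hd]
    exact mul_le_mul' le_rfl hyr
  · rintro ⟨hxN, hxr⟩
    refine ⟨t * x * t⁻¹, ⟨?_, ?_⟩, by group⟩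
    · have h := (torus_inv_conj_mem_unipotentU_iff σ J hti x).2 hxN
      rwa [inv_inv] at h
    · have h := valuation_conj_entry_zero_one_two σ hdi x
      rw [inv_inv] at h
      rw [h]
      calc valuation K ((((d⁻¹ 0)⁻¹ * d⁻¹ 1 : Kˣ) : K)) * valuation K (((x : GL (Fin 2) K) : Matrix (Fin 2) (Fin 2) K) 0 1)
          ≤ valuation K ((((d⁻¹ 0)⁻¹ * d⁻¹ 1 : Kˣ) : K)) * (valuation K (((d 0)⁻¹ * d 1 : Kˣ) : K) * r) := mul_le_mul' le_rfl hxr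
        _ = r := by rw [← mul_assoc, ← map_mul, hbb, map_one, one_mul]

variable (hJ : J = (StdForm.antidiagonal 2).over K)

/-- **(L2)₂ `K_δ ∩ N̄₂` ENTRYWISE**: `x ∈ K_δ ∩ w₀N₂w₀ ↔ x = w₀ u w₀` for some `u ∈ N₂` with `v(u₀₁) ≤ δ` (`δ < 1`; (L2) any-rank + (L1)₂; note `(w₀ u w₀)₁₀ = u₀₁` ★ `coe_weylConj_apply`).
[cite: Casselman1995, Prop. 1.4.4] [cite: Rogawski1990, §1.10 p. 9] -/
theorem mem_level_inf_Nbar_iff_two {δ : ValueGroupWithZero K} (hδ : δ < 1) (x : ↥(unitaryGroupOfForm σ J)) :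
    x ∈ (congruenceGL 2 δ).comap (unitaryGroupOfForm σ J).subtype ⊓ ((borelTriple σ J hJ).N).map (MulAut.conj (weylLongU σ hJ)).toMonoidHom ↔
      ∃ u : ↥(unipotentU σ J), valuation K ((((u : ↥(unitaryGroupOfForm σ J)) : GL (Fin 2) K) : Matrix (Fin 2) (Fin 2) K) 0 1) ≤ δ ∧
        x = weylLongU σ hJ * (u : ↥(unitaryGroupOfForm σ J)) * weylLongU σ hJ := by
  rw [mem_level_inf_Nbar_iff σ hJ]
  constructor
  · rintro ⟨n, hn, hx⟩
    obtain ⟨hnK, hnN⟩ := Subgroup.mem_inf.1 hn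
    rw [borelTriple_N] at hnN
    exact ⟨⟨n, hnN⟩, (mem_level_iff_of_mem_unipotentU_two σ hδ ⟨n, hnN⟩).1 hnK, hx⟩
  · rintro ⟨u, hu, hx⟩
    exact ⟨u, Subgroup.mem_inf.2 ⟨(mem_level_iff_of_mem_unipotentU_two σ hδ u).2 hu, by rw [borelTriple_N]; exact u.2⟩, hx⟩

end Twist

end Summit.HodgeConjecture.HodgeConjecture.Cruxes.H413.F0P3cStCharTSUpTrU2LevelsTwist

end
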